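import Summits.BirchSwinnertonDyer.Rank1Residual.Supersingular.SurjSerreCertificateShape
import Summits.BirchSwinnertonDyer.Rank1Residual.GaloisImage.FrobeniusOrderWitness
import HarnessLib

/-!
# `surj(p)` for a LITERAL integer equation from TWO Frobenius witnesses — one with IRREDUCIBLE
# characteristic polynomial, one of ORDER `p` (x11c's `GaloisImage/FrobeniusOrderWitness`, any
# prime `p`, in particular `p = 3`) — the record shape that retires the `hsurj` DATA binder of the
# rank-one rem13 records at `p = 3` (cell `b2b-bsdres`, supersingular family prover B = unit
# `b2b-bsdres-additive-p3`, gen 21; TOOL)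

HONEST FRAMING (run/shared/lean/b2b/bsd-rank1-residual/, verbatim in every file): the goal of the
cell is to DELETE the COMBINATION-SHAPED residual classes of the Birch–Swinnerton-Dyer formula for
ALL analytic-rank `≤ 1` elliptic curves over `ℚ` — "full BSD formula for every rank `≤ 1` curve in
class `C`" assembled STRICTLY from published theorems — so that the rank-`≤ 1` remainder becomes
exactly the CONSTRUCTION-SHAPED classes, which are TYPED (missing-input `Prop`s), NOT attempted.
This is not "finishing BSD". THEOREMS ONLY (no definition, no named fact); nothing booked.

Gen 20 retired the `hsurj` binder of the `p ≥ 5` rank-one records by Serre's Prop. 19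
(`SurjSerreCertificateShape.lean`, p303036; 994 certificates `surj_x7r1_*`). Prop. 19 needs `p ≥ 5`.
At `p = 3` — ALL 74 class-X8 (O3) records and the 183 class-X7 (O4) records at `p = 3` — x11c's
`GaloisImage.hasSurjectiveModNGaloisRep_of_intModel_of_irr_of_order` (gen 6) gives `ρ̄_{E,p}` onto,
for ANY prime `p`, from two good primes `ℓ₁, ℓ₂ ≠ p`: (i) `X² − a_{ℓ₁}X + ℓ₁` irreducible mod `p`
(the image lies in no Borel subgroup); (ii) `ℓ₂ ≡ 1`, `a_{ℓ₂} ≡ 2 (mod p)` and `p² ∤ #Ẽ(𝔽_{ℓ₂})`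
(the Frobenius at `ℓ₂` is a NON-IDENTITY transvection on `E[p]` — if it were the identity, `E[p]`
would inject into `Ẽ(𝔽_{ℓ₂})`, Silverman VII.3.1 (b) —, hence of order `p`); then Serre's Prop. 15
with `det = χ̄_p` onto. This file packages it for a LITERAL equation `[a₁,…,a₆]` with every
hypothesis in `decide`-able form, exactly as the gen-20 Serre shape: global minimality explicit
(x11c's bounded Kraus/Silverman criterion or gen 20's criterion₃), the two counts as schema counts
`countPoints [a] ℓᵢ = nᵢ` (x11c's `natCard_point_eq_countPoints`), (i) as a `∀ c : ZMod p`
(a finite check), (ii) as three numeral facts. Consumers: the `hsurj : Surj W 3` binder of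
`RankOneRem13RecordsX8Unit*/X8ShaNine*/X7Unit*/X7ShaNine*` at `p = 3` (257 rows; witness primes
`ℓ₁ ≤ 41`, `ℓ₂ ≤ 211`, HOME/b2b-bsdres-additive-p3/g21/census/frob3_witnesses.json).
* `surj_of_ainvs_of_irr_of_order` — the shape (any prime `p`).
* `surj_three_of_ainvs_of_irr_of_order` — the `p = 3` instance with the prime fact supplied.

References: J.-P. Serre, Invent. Math. 15 (1972) §2.4 Prop. 15, §2.6, §5.2 (iii) [Serre1972];
J. H. Silverman, *AEC* (2009) III.6.4 (b), VII.1, VII.3.1 (b), VII.4.1 (a) [SilvermanAEC2009];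
K. Ireland, M. Rosen, GTM 84 (1990) Prop. 5.1.2, §8.1 [IrelandRosen1990].
-/

set_option autoImplicit false

noncomputable section

open scoped Classical

open WeierstrassCurve Literature.NumberTheory.EllipticCurves
  Literature.NumberTheory.EllipticCurves.Rank1Residual
  Literature.NumberTheory.EllipticCurves.Rank1Residual.X11RankOneCertificates
  Summit.BirchSwinnertonDyer.BirchSwinnertonDyer.Rank1Residual.IntModel
  Summit.BirchSwinnertonDyer.BirchSwinnertonDyer.Rank1Residual.X11RankOne
  Summit.BirchSwinnertonDyer.Rank1Residual.X11b
  Summit.BirchSwinnertonDyer.Rank1Residual.GaloisImage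

namespace Summit.BirchSwinnertonDyer.Rank1Residual.Supersingular

/-- **CERTIFICATE SHAPE: `surj(p)` (any prime `p`) for the literal equation `[a₁,…,a₆]` from two
Frobenius witnesses**, all hypotheses kernel-decidable: `hmin` global minimality (explicit), odd good
primes `ℓ₁, ℓ₂ ∤ Δ`, `ℓᵢ ≠ p`, schema counts `countPoints [a] ℓᵢ = nᵢ` (`aᵢ = ℓᵢ + 1 − nᵢ`), and
(i) `X² − a₁X + ℓ₁` has no root in `𝔽_p`, (ii) `ℓ₂ ≡ 1`, `a₂ ≡ 2 (mod p)`, `p² ∤ n₂` (a Frobenius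
of order `p`). x11c's `hasSurjectiveModNGaloisRep_of_intModel_of_irr_of_order` on the integral
model `integralModelInt ⟨a⟩ = ⟨a⟩`. [cite: Serre1972, §2.4 Prop. 15 and §5.2 (iii)]
[cite: SilvermanAEC2009, VII.3.1(b) and III.6.4(b)] [cite: IrelandRosen1990, Prop. 5.1.2] -/
theorem surj_of_ainvs_of_irr_of_order (a1 a2 a3 a4 a6 : ℤ) (p : ℕ) [Fact p.Prime]
    (hmin : (⟨a1, a2, a3, a4, a6⟩ : WeierstrassCurve ℚ).IsGloballyMinimal)
    (ℓ₁ ℓ₂ : ℕ) (hℓ₁ : ℓ₁.Prime) (hℓ₂ : ℓ₂.Prime) (h2₁ : ℓ₁ ≠ 2) (h2₂ : ℓ₂ ≠ 2)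
    (h₁ : ℓ₁ ≠ p) (h₂ : ℓ₂ ≠ p)
    (hΔ₁ : ¬ (ℓ₁ : ℤ) ∣ discOf [a1, a2, a3, a4, a6]) (hΔ₂ : ¬ (ℓ₂ : ℤ) ∣ discOf [a1, a2, a3, a4, a6])
    {n₁ n₂ : ℕ} (hc₁ : countPoints [a1, a2, a3, a4, a6] ℓ₁ = n₁)
    (hc₂ : countPoints [a1, a2, a3, a4, a6] ℓ₂ = n₂)
    (hirr : ∀ c : ZMod p, c ^ 2 - (((ℓ₁ : ℤ) + 1 - n₁ : ℤ) : ZMod p) * c + ℓ₁ ≠ 0)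
    (hdet₂ : (ℓ₂ : ZMod p) = 1) (htr₂ : (((ℓ₂ : ℤ) + 1 - n₂ : ℤ) : ZMod p) = 2)
    (hsq : ¬ p ^ 2 ∣ n₂) :
    Surj (⟨a1, a2, a3, a4, a6⟩ : WeierstrassCurve ℚ) p := by
  have h0 : discOf [a1, a2, a3, a4, a6] ≠ 0 := fun h ↦ hΔ₁ (by rw [h]; exact dvd_zero _)
  haveI := isElliptic_of_discOf_ne_zero a1 a2 a3 a4 a6 h0
  haveI := hmin
  haveI : Fact ℓ₁.Prime := ⟨hℓ₁⟩
  haveI : Fact ℓ₂.Prime := ⟨hℓ₂⟩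
  have hI : integralModelInt (⟨a1, a2, a3, a4, a6⟩ : WeierstrassCurve ℚ) = ⟨a1, a2, a3, a4, a6⟩ :=
    integralModelInt_eq_of_map_eq _ (map_mk_int a1 a2 a3 a4 a6)
  exact hasSurjectiveModNGaloisRep_of_intModel_of_irr_of_order hI p ℓ₁ ℓ₂ h₁ h₂
    (by rw [intCurve_Δ]; exact hΔ₁) (by rw [intCurve_Δ]; exact hΔ₂)
    (natCard_point_eq_of_countPoints a1 a2 a3 a4 a6 ℓ₁ h2₁ hΔ₁ hc₁)
    (natCard_point_eq_of_countPoints a1 a2 a3 a4 a6 ℓ₂ h2₂ hΔ₂ hc₂) hirr hdet₂ htr₂ hsq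

/-- **CERTIFICATE SHAPE at `p = 3`** (the X8 / X7@3 rank-one records): `surj(3)` for the literal
equation `[a₁,…,a₆]` from an irreducible Frobenius at `ℓ₁` and a Frobenius of order `3` at `ℓ₂`
(`ℓ₂ ≡ 1`, `a_{ℓ₂} ≡ 2 (mod 3)`, `9 ∤ #Ẽ(𝔽_{ℓ₂})`); `surj_of_ainvs_of_irr_of_order` at `p = 3`.
[cite: Serre1972, §2.4 Prop. 15 and §5.2 (iii)] [cite: SilvermanAEC2009, VII.3.1(b) and III.6.4(b)]
[cite: IrelandRosen1990, Prop. 5.1.2] -/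
theorem surj_three_of_ainvs_of_irr_of_order (a1 a2 a3 a4 a6 : ℤ)
    (hmin : (⟨a1, a2, a3, a4, a6⟩ : WeierstrassCurve ℚ).IsGloballyMinimal)
    (ℓ₁ ℓ₂ : ℕ) (hℓ₁ : ℓ₁.Prime) (hℓ₂ : ℓ₂.Prime) (h2₁ : ℓ₁ ≠ 2) (h2₂ : ℓ₂ ≠ 2)
    (h₁ : ℓ₁ ≠ 3) (h₂ : ℓ₂ ≠ 3)
    (hΔ₁ : ¬ (ℓ₁ : ℤ) ∣ discOf [a1, a2, a3, a4, a6]) (hΔ₂ : ¬ (ℓ₂ : ℤ) ∣ discOf [a1, a2, a3, a4, a6])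
    {n₁ n₂ : ℕ} (hc₁ : countPoints [a1, a2, a3, a4, a6] ℓ₁ = n₁)
    (hc₂ : countPoints [a1, a2, a3, a4, a6] ℓ₂ = n₂)
    (hirr : ∀ c : ZMod 3, c ^ 2 - (((ℓ₁ : ℤ) + 1 - n₁ : ℤ) : ZMod 3) * c + ℓ₁ ≠ 0)
    (hdet₂ : (ℓ₂ : ZMod 3) = 1) (htr₂ : (((ℓ₂ : ℤ) + 1 - n₂ : ℤ) : ZMod 3) = 2)
    (hsq : ¬ 9 ∣ n₂) :
    Surj (⟨a1, a2, a3, a4, a6⟩ : WeierstrassCurve ℚ) 3 :=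
  @surj_of_ainvs_of_irr_of_order a1 a2 a3 a4 a6 3 ⟨by norm_num⟩ hmin ℓ₁ ℓ₂ hℓ₁ hℓ₂ h2₁ h2₂ h₁ h₂
    hΔ₁ hΔ₂ n₁ n₂ hc₁ hc₂ hirr hdet₂ htr₂ (by norm_num; exact hsq)

end Summit.BirchSwinnertonDyer.Rank1Residual.Supersingular

end
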